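import Summits.BirchSwinnertonDyer.BirchSwinnertonDyer.Theorems.GoldfeldAllTwistsTwoConverseTwinHalfTraceThreeModEightAntiHalving
import HarnessLib

set_option linter.dupNamespace false -- namespace `…BirchSwinnertonDyer.BirchSwinnertonDyer…` is the cell's (D-0017 nested layout)
set_option autoImplicit false

/-!
# Twin″ (item 19140), LINE U, file U4⁻ — THE SECOND HALVING as pure `2`-descent algebra on `X₀(49)` (fact-free)

Cell `bsd-goldfeld`, seat `bsd-goldfeld-s1p-c301` (prover, gen 14); ORDER «LINE U» (planner (cliii)/(clxi)/(clxiv): file 6 of 7, «U4⁻ = the DESCENT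
HALF, bankable on its own»); `--supports stmt-BirchSwinnertonDyer-19140` as a HELPER; memo `HOME/INERT7-UNIT-CIRCLE.md` §4 (C1) and §6′. FACT-FREE,
Theses-free, theorems only: pure `2`-descent algebra on `E = X₀(49)` over an arbitrary field `F` of characteristic `0`, on seat c3's normal form
`V = cm7NFChange • E : Y² = X(X² + 21X + 112)` with the tree's descent map `xSqClass` (`α(x,y) = [x − 2]`, `α(T) = [7]`, `α` additive;
pattern of `…TwinHalfTraceThreeModEightAntiHalving` §2).

* §1 square classes: `[2], [14] ∉ {1, [7]}` when `2, 14 ∉ F²`; even/odd powers in `F^×/F^{×2}`.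
* §2 **`secondHalving_cm7`** — THE SECOND HALVING: with `−7, 7, 2, 14 ∉ F²`, points `P_a, P_ℓ, G = (x_G, ·), G′ = (x_{G′}, ·)`,
  torsion `t₁, t₂`, a signed sum `D = Σ_{i∈S} ε_i (x_i, y_i)` with `∏(x_i − 2) ∈ F²`, and relations `P_a − P_ℓ = 2D`, `2P_a = N₀G + t₁`,
  `2P_ℓ = M₀G′ + t₂`, `α(G), α(G′) ∈ {[2],[14]}`, `M₀ = 4m′`, `m′` odd ⟹ **`N₀ = 4N′`, `N′` odd**.
* §3 `sum_sign_smul_sub_eq_two_smul` (`P_s − P_{s′} = 2Σ_{s≠s′} s·Y`) and `div_mul_sq_eq_neg_one_and_map_eq_neg_iff` (`√−1 = θ/(√a√ℓ)`;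
  an automorphism fixing `θ = √(−aℓ)` negates `√−1` iff its signs on `√a`, `√ℓ` differ).

HOW IT IS MEANT TO BE USED (file 7 / next generation, memo §6′): `F = K[1]` for `K = ℚ(√−aℓ)` (`±7 ∉ K[1]²` by
`sqrt_intCast_not_mem_ringClassField`; `2, 14 ∉ K[1]²` = the ruled inline hypothesis `hsqrt2`, Cox Thm 6.1), `Y_σ = σ•y(1)`, `s = s_a`, `s′ = s_ℓ`
(cut out by `√a`, `√ℓ`), `D = Σ_{s_a ≠ s_ℓ} s_a(σ)·σy` whose `α`-class is trivial by U2d `isSquare_prod_filter_ringClassGal` (§3 identifies the index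
set with «`σ√−1 = −√−1`»), `2P_a = N₀·Φ(g_W) + t₁` from XII `two_smul_genusSum_eq_of_inertSeven`, `2P_ℓ = M₀·Φ′(g_a) + t₂` with `v₂(M₀) = 2`
(the s_ℓ-PARTNER LAW, THEOREM B + `ord₂ L^{alg}(49a1^{(ℓ)},1) = 1`, not yet typed), `α(Φ g_W), α(Φ′ g_a) ∈ {[2],[14]}` (`S(−ℓ) = {1,7,2ℓ,14ℓ}`, VIII);
then `v₂(N₀) = 2` is XIV's index law `ord₂[W(ℚ):ℤP₀] = 3`, i.e. `BSD(W,2)` on `𝒮|σ=−1` (`Ш(W)[2^∞] = 0` by `bsdp_two_iff_shaAn_unit_splitPrimeTwist`).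
HONEST FRAMING: nothing here mentions `L`-functions, Heegner points or BSD; no twist is decided by this file; items unchanged; BSD is not proved.
References: J. H. Silverman, J. Tate, *Rational Points on Elliptic Curves* (2015) §3.5 [SilvermanTate2015]; J. H. Silverman, *AEC* (2009) X.4
Prop. 4.9 [SilvermanAEC2009].
-/

noncomputable section

open scoped Classical

open WeierstrassCurve Literature.NumberTheory.EllipticCurves
open WeierstrassCurve.Affine (sqClass sqClass_mul sqClass_sq sqClass_eq_one_iff)

namespace Summit.BirchSwinnertonDyer.BirchSwinnertonDyer.Theorems.GoldfeldGoodTwists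

/-! ## §1 Square classes of `2`, `7`, `14` -/

section SqClasses

variable {F : Type*} [Field F] [CharZero F]

omit [CharZero F] in
/-- `sqClass a = 1` for `a ≠ 0` means `a` is a square. [folklore] -/
theorem isSquare_of_sqClass_eq_one {a : F} (ha : a ≠ 0) (h : sqClass a = 1) : IsSquare a := by
  obtain ⟨u, hu⟩ := (sqClass_eq_one_iff ha).mp h
  exact ⟨u, by rw [hu, pow_two]⟩

omit [CharZero F] in
/-- In `F^×/F^{×2}`: `a·b = 1 ⟹ a = b`. [folklore] -/
theorem sqUnits_eq_of_mul_eq_one {a b : Affine.SqUnits F} (h : a * b = 1) : a = b := by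
  rw [Affine.SqUnits.eq_mul_of_mul_eq h, Affine.SqUnits.one_mul]

/-- The classes `[2]` and `[14]` avoid `{1, [7]}` when `2` and `14` are not squares in `F`. [folklore] -/
theorem sqClass_ne_one_and_ne_seven (h2 : ¬ IsSquare (2 : F)) (h14 : ¬ IsSquare (14 : F)) {g : Affine.SqUnits F}
    (hg : g = sqClass (2 : F) ∨ g = sqClass (14 : F)) : g ≠ 1 ∧ g ≠ sqClass (7 : F) := by
  have h27 : sqClass (2 : F) * sqClass (7 : F) = sqClass (14 : F) := by
    rw [← sqClass_mul (by norm_num) (by norm_num)]; norm_num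
  rcases hg with rfl | rfl
  · refine ⟨fun h ↦ h2 (isSquare_of_sqClass_eq_one two_ne_zero h), fun h ↦ h14 ?_⟩
    apply isSquare_of_sqClass_eq_one (by norm_num)
    rw [← h27, ← h, Affine.SqUnits.mul_self]
  · refine ⟨fun h ↦ h14 (isSquare_of_sqClass_eq_one (by norm_num) h), fun h ↦ h2 ?_⟩
    apply isSquare_of_sqClass_eq_one two_ne_zero
    calc sqClass (2 : F) = sqClass 2 * (sqClass (7 : F) * sqClass 7) := by
          rw [Affine.SqUnits.mul_self, Affine.SqUnits.mul_one]
      _ = sqClass 2 * sqClass 7 * sqClass 7 := by rw [mul_assoc]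
      _ = 1 := by rw [h27, h, Affine.SqUnits.mul_self]

omit [CharZero F] in
/-- `IsSquare (c·v)` with `c, v ≠ 0` reads `sqClass v = sqClass c`. [folklore] -/
theorem sqClass_eq_of_isSquare_mul {c v : F} (hc : c ≠ 0) (hv : v ≠ 0) (h : IsSquare (c * v)) :
    sqClass v = sqClass c := by
  obtain ⟨r, hr⟩ := h
  have h1 : sqClass (c * v) = 1 := by rw [hr, ← pow_two, sqClass_sq]
  rw [sqClass_mul hc hv] at h1
  exact (sqUnits_eq_of_mul_eq_one h1).symm

omit [CharZero F] in
/-- Powers in a group of exponent `2`: even exponents give `1`, odd exponents give the element. [folklore] -/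
theorem sqUnits_zpow_eq (g : Affine.SqUnits F) (n : ℤ) : (Even n → g ^ n = 1) ∧ (Odd n → g ^ n = g) := by
  constructor
  · rintro ⟨k, rfl⟩
    rw [zpow_add, Affine.SqUnits.mul_self]
  · rintro ⟨k, rfl⟩
    rw [zpow_add, zpow_one, two_mul, zpow_add, Affine.SqUnits.mul_self, Affine.SqUnits.one_mul]

end SqClasses

/-! ## §2 The second halving on `X₀(49)(F)` -/

section SecondHalving

variable {F : Type*} [Field F] [CharZero F]

/-- If a non-zero multiple of `u` has finite order then so has `u`. [folklore] -/
theorem isOfFinAddOrder_of_zsmul {A : Type*} [AddCommGroup A] {k : ℤ} (hk : k ≠ 0) {u : A}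
    (h : IsOfFinAddOrder (k • u)) : IsOfFinAddOrder u := by
  obtain ⟨n, hn, hnu⟩ := (isOfFinAddOrder_iff_zsmul_eq_zero).mp h
  exact (isOfFinAddOrder_iff_zsmul_eq_zero).mpr ⟨n * k, mul_ne_zero hn hk, by rw [mul_smul, hnu]⟩

/-- **THE SECOND HALVING (abstract `2`-descent on `X₀(49)(F)`).** Let `F` be a field of characteristic `0` in which `−7, 7, 2, 14`
are not squares. On `E = X₀(49)/F` (`cm7`, `T = (2, −1)`, descent map `α(x, y) = [x − 2] ∈ F^×/F^{×2}`, `α(T) = [7]`) let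
`P_a, P_ℓ, G, G′, t₁, t₂` be points and `D = Σ_{i ∈ S} ε_i·(x_i, y_i)` a signed sum of affine points with `x_i ≠ 2` and
`∏_i (x_i − 2)` a square (`α(D) = 1`), such that `P_a − P_ℓ = 2D`, `2P_a = N₀·G + t₁`, `2P_ℓ = M₀·G′ + t₂` (`t₁, t₂` torsion),
`α(G), α(G′) ∈ {[2], [14]}` and `M₀ = 4m′` with `m′` odd. Then **`N₀ = 4N′` with `N′` ODD**. (Three applications of `α`: `N₀` even from
`α(G)^{N₀} ∈ α(torsion) ⊆ {1,[7]}`; `N₀/2` even likewise from `P_a − P_ℓ = 2D`; then the torsion residue is killed by an odd `n` — it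
cannot be `T` since `T ∉ 2E(F)` (`7 ∉ F²`) — and the resulting `2`-torsion point `X ∈ {O, T}` has `α(X) = α(G)^{N′}·α(G′)`, forcing
`N′` odd.) [cite: SilvermanTate2015, §3.5] [cite: SilvermanAEC2009, X.4 Prop. 4.9] -/
theorem secondHalving_cm7 (h7n : ¬ IsSquare (-7 : F)) (h7 : ¬ IsSquare (7 : F)) (h2 : ¬ IsSquare (2 : F))
    (h14 : ¬ IsSquare (14 : F))
    {ι : Type*} (S : Finset ι) (x y : ι → F) (hxy : ∀ i, (cm7.baseChange F).toAffine.Nonsingular (x i) (y i))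
    (hx2 : ∀ i ∈ S, x i ≠ 2) (ε : ι → ℤˣ) (hD : IsSquare (∏ i ∈ S, (x i - 2)))
    (Pa Pl t₁ t₂ : (cm7.baseChange F).toAffine.Point) (ht₁ : IsOfFinAddOrder t₁) (ht₂ : IsOfFinAddOrder t₂)
    {xG yG xG' yG' : F} (hG : (cm7.baseChange F).toAffine.Nonsingular xG yG)
    (hG' : (cm7.baseChange F).toAffine.Nonsingular xG' yG') (hxG : xG ≠ 2) (hxG' : xG' ≠ 2)
    (hαG : IsSquare (2 * (xG - 2)) ∨ IsSquare (14 * (xG - 2)))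
    (hαG' : IsSquare (2 * (xG' - 2)) ∨ IsSquare (14 * (xG' - 2)))
    (N₀ M₀ m' : ℤ) (hM₀ : M₀ = 4 * m') (hm' : Odd m')
    (hrel : Pa - Pl = (2 : ℤ) • ∑ i ∈ S, ((ε i : ℤ) • Affine.Point.some (x i) (y i) (hxy i)))
    (h2a : (2 : ℤ) • Pa = N₀ • Affine.Point.some xG yG hG + t₁)
    (h2l : (2 : ℤ) • Pl = M₀ • Affine.Point.some xG' yG' hG' + t₂) :
    ∃ N' : ℤ, Odd N' ∧ N₀ = 4 * N' := by
  ------------------------------------------------------------------ the descent map `α = xSqClass ∘ e` on the normal form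
  set V : WeierstrassCurve F := cm7NFChange F • cm7.baseChange F with hV
  have hVeq : V = ⟨0, 21, 0, 112, 0⟩ := cm7NFChange_smul
  haveI : V.IsTwoTorsionNF := by rw [hVeq]; infer_instance
  have ha₄ : V.a₄ = 112 := by rw [hVeq]
  set e : (cm7.baseChange F).toAffine.Point ≃+ V.toAffine.Point :=
    VariableChange.pointEquiv (cm7.baseChange F) (cm7NFChange F) with he_def
  set α : (cm7.baseChange F).toAffine.Point → Affine.SqUnits F := fun P ↦ V.xSqClass (e P) with hα_def
  have hα0 : α 0 = 1 := by simp only [hα_def, map_zero, xSqClass_zero]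
  have hαadd : ∀ P Q, α (P + Q) = α P * α Q := fun P Q ↦ by simp only [hα_def, map_add, xSqClass_add]
  have hαneg : ∀ P, α (-P) = α P := fun P ↦ by simp only [hα_def, map_neg, xSqClass_neg]
  have hαsub : ∀ P Q, α (P - Q) = α P * α Q := fun P Q ↦ by rw [sub_eq_add_neg, hαadd, hαneg]
  have hαz : ∀ (n : ℤ) (P), α (n • P) = α P ^ n := fun n P ↦ by
    simp only [hα_def]
    have h1 : V.xSqClass (e (n • P)) = (V.xSqClassHom (Multiplicative.ofAdd (e P))) ^ n := by
      rw [← map_zpow V.xSqClassHom (Multiplicative.ofAdd (e P)) n, ← ofAdd_zsmul, map_zsmul]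
      rfl
    rw [h1]; rfl
  -- values: affine points with `x ≠ 2`, and `T`
  have hαpt : ∀ {u v : F} (h : (cm7.baseChange F).toAffine.Nonsingular u v), u ≠ 2 →
      α (Affine.Point.some u v h) = sqClass (u - 2) := by
    intro u v h hu
    have hu' : u - 2 ≠ 0 := sub_ne_zero.mpr hu
    have hg' := (VariableChange.nonsingular_iff (cm7.baseChange F) (cm7NFChange F) u v).mpr h
    have he : e (Affine.Point.some u v h) = .some ((cm7NFChange F).toX u) ((cm7NFChange F).toY u v) hg' :=
      VariableChange.pointEquiv_some _ _ h
    have hx0 : (cm7NFChange F).toX u ≠ 0 := by rw [cm7NFChange_toX]; exact mul_ne_zero (by norm_num) hu'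
    simp only [hα_def]
    rw [he, xSqClass_some_of_ne_zero hg' hx0, cm7NFChange_toX, sqClass_mul (by norm_num) hu',
      show (4 : F) = 2 ^ 2 by norm_num, sqClass_sq, Affine.SqUnits.one_mul]
  have hαT : α (Affine.Point.some 2 (-1) (nonsingular_cm7_baseChange_two_neg_one F)) = sqClass (7 : F) := by
    have hg' := (VariableChange.nonsingular_iff (cm7.baseChange F) (cm7NFChange F) 2 (-1)).mpr
      (nonsingular_cm7_baseChange_two_neg_one F)
    have he : e (Affine.Point.some 2 (-1) (nonsingular_cm7_baseChange_two_neg_one F)) =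
        .some ((cm7NFChange F).toX 2) ((cm7NFChange F).toY 2 (-1)) hg' := VariableChange.pointEquiv_some _ _ _
    have hx0 : (cm7NFChange F).toX 2 = 0 := by rw [cm7NFChange_toX]; ring
    simp only [hα_def]
    rw [he, xSqClass_some_of_eq_zero hg' hx0, ha₄, show (112 : F) = 7 * 4 ^ 2 by norm_num,
      sqClass_mul (by norm_num) (by norm_num), sqClass_sq, Affine.SqUnits.mul_one]
  -- torsion has class in `{1, [7]}`
  have hαtors : ∀ t, IsOfFinAddOrder t → α t = 1 ∨ α t = sqClass (7 : F) := by
    intro t ht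
    obtain ⟨n, hn, h⟩ := cm7_exists_odd_nsmul_mem_pair h7n h7 ht
    have hodd : Odd (n : ℤ) := by exact_mod_cast hn
    have hnt : α ((n : ℤ) • t) = α t := by rw [hαz, (sqUnits_zpow_eq (α t) n).2 hodd]
    rw [natCast_zsmul] at hnt
    rcases h with h0 | hT
    · left; rw [← hnt, h0, hα0]
    · right; rw [← hnt, hT, hαT]
  -- `α(D) = 1`
  set D := ∑ i ∈ S, ((ε i : ℤ) • Affine.Point.some (x i) (y i) (hxy i)) with hD_def
  have hαD : α D = 1 := by
    have hsum : ∀ S' : Finset ι, (∀ i ∈ S', x i ≠ 2) →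
        α (∑ i ∈ S', ((ε i : ℤ) • Affine.Point.some (x i) (y i) (hxy i))) = sqClass (∏ i ∈ S', (x i - 2)) := by
      intro S' hS'
      induction S' using Finset.induction_on with
      | empty => rw [Finset.sum_empty, Finset.prod_empty, hα0, show (1 : F) = 1 ^ 2 by norm_num, sqClass_sq]
      | insert a s ha ih =>
        rw [Finset.sum_insert ha, Finset.prod_insert ha, hαadd, hαz,
          (sqUnits_zpow_eq _ _).2 (Int.units_eq_one_or (ε a) |>.elim (fun h ↦ by rw [h]; exact odd_one)
            (fun h ↦ by rw [h]; exact Int.odd_iff.mpr rfl)),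
          hαpt (hxy a) (hS' a (Finset.mem_insert_self a s)), ih (fun i hi ↦ hS' i (Finset.mem_insert_of_mem hi)),
          ← sqClass_mul (sub_ne_zero.mpr (hS' a (Finset.mem_insert_self a s)))
            (Finset.prod_ne_zero_iff.mpr fun i hi ↦ sub_ne_zero.mpr (hS' i (Finset.mem_insert_of_mem hi)))]
    rw [hD_def, hsum S hx2]
    obtain ⟨r, hr⟩ := hD
    rw [hr, ← pow_two, sqClass_sq]
  ------------------------------------------------------------------ the classes of `G`, `G′`
  set G := Affine.Point.some xG yG hG with hG_def
  set G' := Affine.Point.some xG' yG' hG' with hG'_def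
  have hgG : α G = sqClass (2 : F) ∨ α G = sqClass (14 : F) := by
    rw [hG_def, hαpt hG hxG]
    rcases hαG with h | h
    · exact Or.inl (sqClass_eq_of_isSquare_mul two_ne_zero (sub_ne_zero.mpr hxG) h)
    · exact Or.inr (sqClass_eq_of_isSquare_mul (by norm_num) (sub_ne_zero.mpr hxG) h)
  have hgG' : α G' = sqClass (2 : F) ∨ α G' = sqClass (14 : F) := by
    rw [hG'_def, hαpt hG' hxG']
    rcases hαG' with h | h
    · exact Or.inl (sqClass_eq_of_isSquare_mul two_ne_zero (sub_ne_zero.mpr hxG') h)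
    · exact Or.inr (sqClass_eq_of_isSquare_mul (by norm_num) (sub_ne_zero.mpr hxG') h)
  obtain ⟨hG1, hG7⟩ := sqClass_ne_one_and_ne_seven h2 h14 hgG
  obtain ⟨hG'1, hG'7⟩ := sqClass_ne_one_and_ne_seven h2 h14 hgG'
  -- parity from a class equation `α(G)^N · b = 1`, `b ∈ {1,[7]}`
  have heven : ∀ (N : ℤ) (b : Affine.SqUnits F), (b = 1 ∨ b = sqClass (7 : F)) → α G ^ N * b = 1 → Even N := by
    intro N b hb h
    by_contra hN
    rw [Int.not_even_iff_odd] at hN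
    rw [(sqUnits_zpow_eq _ _).2 hN] at h
    have hGb : α G = b := sqUnits_eq_of_mul_eq_one h
    rcases hb with rfl | rfl
    · exact hG1 hGb
    · exact hG7 hGb
  ------------------------------------------------------------------ step 1: `N₀` is even
  have hstep1 : N₀ • G - M₀ • G' + (t₁ - t₂) = (4 : ℤ) • D := by
    have h := congrArg (fun P ↦ (2 : ℤ) • P) hrel
    simp only [smul_sub, h2a, h2l, smul_smul] at h
    rw [show (2 : ℤ) * 2 = 4 by norm_num] at h
    rw [← h]; abel
  have hM₀even : α G' ^ M₀ = 1 := (sqUnits_zpow_eq _ _).1 ⟨2 * m', by rw [hM₀]; ring⟩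
  have hN₀even : Even N₀ := by
    have h := congrArg α hstep1
    rw [hαadd, hαsub, hαz, hαz, hM₀even, Affine.SqUnits.mul_one, hαz, hαD, one_zpow] at h
    exact heven N₀ (α (t₁ - t₂)) (hαtors _ ((AddCommGroup.mem_torsion _).mp
      (sub_mem ((AddCommGroup.mem_torsion _).mpr ht₁) ((AddCommGroup.mem_torsion _).mpr ht₂)))) h
  obtain ⟨Na, hNa⟩ := hN₀even
  ------------------------------------------------------------------ step 2: `N₀/2` is even
  set Ra := Pa - Na • G with hRa_def
  set Rl := Pl - (2 * m') • G' with hRl_def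
  have hRa : IsOfFinAddOrder Ra := by
    refine isOfFinAddOrder_of_zsmul (two_ne_zero) ?_
    have : (2 : ℤ) • Ra = t₁ := by
      rw [hRa_def, smul_sub, h2a, hNa, smul_smul, ← two_mul, add_sub_cancel_left]
    rw [this]; exact ht₁
  have hRl : IsOfFinAddOrder Rl := by
    refine isOfFinAddOrder_of_zsmul (two_ne_zero) ?_
    have : (2 : ℤ) • Rl = t₂ := by
      rw [hRl_def, smul_sub, h2l, hM₀, smul_smul, show (2 : ℤ) * (2 * m') = 4 * m' by ring, add_sub_cancel_left]
    rw [this]; exact ht₂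
  have hstep2 : Na • G - (2 * m') • G' + (Ra - Rl) = (2 : ℤ) • D := by
    rw [← hrel, hRa_def, hRl_def]; abel
  have hm2 : α G' ^ (2 * m') = 1 := (sqUnits_zpow_eq _ _).1 ⟨m', two_mul m'⟩
  have hNaeven : Even Na := by
    have h := congrArg α hstep2
    rw [hαadd, hαsub, hαz, hαz, hm2, Affine.SqUnits.mul_one, hαz, hαD, one_zpow] at h
    exact heven Na (α (Ra - Rl)) (hαtors _ ((AddCommGroup.mem_torsion _).mp
      (sub_mem ((AddCommGroup.mem_torsion _).mpr hRa) ((AddCommGroup.mem_torsion _).mpr hRl)))) h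
  obtain ⟨N', hN'⟩ := hNaeven
  ------------------------------------------------------------------ step 3: kill the torsion residue, `N′` is odd
  set X₀ := D - N' • G + m' • G' with hX₀_def
  have hR : Ra - Rl = (2 : ℤ) • X₀ := by
    have h := hstep2
    rw [hN'] at h
    have h' : Ra - Rl = (2 : ℤ) • D - (N' • G + N' • G) + (m' • G' + m' • G') := by
      rw [← h, add_smul, show (2 * m') • G' = m' • G' + m' • G' by rw [two_mul, add_smul]]
      abel
    rw [h', hX₀_def, smul_add, smul_sub, two_smul ℤ (N' • G), two_smul ℤ (m' • G')]
  have hRtors : IsOfFinAddOrder (Ra - Rl) := (AddCommGroup.mem_torsion _).mp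
    (sub_mem ((AddCommGroup.mem_torsion _).mpr hRa) ((AddCommGroup.mem_torsion _).mpr hRl))
  obtain ⟨n, hn, hcase⟩ := cm7_exists_odd_nsmul_mem_pair h7n h7 hRtors
  set X := (n : ℤ) • X₀ with hX_def
  have h2X : (2 : ℤ) • X = n • (Ra - Rl) := by
    rw [hX_def, smul_smul, mul_comm, ← smul_smul, ← hR, natCast_zsmul]
  have hαX : α X = α G ^ N' * α G' := by
    rw [hX_def, hαz, (sqUnits_zpow_eq _ _).2 (by exact_mod_cast hn), hX₀_def, hαadd, hαsub, hαD, Affine.SqUnits.one_mul,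
      hαz, hαz, (sqUnits_zpow_eq _ _).2 hm']
  -- the residue is not `T`: `T ∉ 2E(F)`
  have hX0 : X + X = 0 := by
    rcases hcase with h0 | hT
    · rw [← two_smul ℤ, h2X, h0]
    · exfalso
      apply h7
      apply isSquare_of_sqClass_eq_one (by norm_num)
      rw [← hαT, ← hT, ← h2X, hαz]
      exact (sqUnits_zpow_eq _ _).1 ⟨1, rfl⟩
  -- `X ∈ {O, T}`, so `α X ∈ {1, [7]}`
  have hXtors : IsOfFinAddOrder X :=
    (isOfFinAddOrder_iff_zsmul_eq_zero).mpr ⟨2, two_ne_zero, by rw [two_smul, hX0]⟩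
  obtain ⟨k, hk, hkX⟩ := cm7_exists_odd_nsmul_mem_pair h7n h7 hXtors
  have hkX' : (k : ℤ) • X = X := zsmul_eq_self_of_odd_of_add_self_eq_zero hX0 (by exact_mod_cast hk)
  rw [natCast_zsmul] at hkX'
  rw [hkX'] at hkX
  have hαX' : α X = 1 ∨ α X = sqClass (7 : F) := by
    rcases hkX with h0 | hT
    · left; rw [h0, hα0]
    · right; rw [hT, hαT]
  -- `N′` is odd
  have hN'odd : Odd N' := by
    by_contra hN
    rw [Int.not_odd_iff_even] at hN
    rw [hαX, (sqUnits_zpow_eq _ _).1 hN, Affine.SqUnits.one_mul] at hαX'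
    rcases hαX' with h | h
    · exact hG'1 h
    · exact hG'7 h
  exact ⟨N', hN'odd, by rw [hNa, hN']; ring⟩

end SecondHalving


/-! ## §3 The two genus sums differ by twice a signed sum; the anti-`√−1` classes are those where the signs differ -/

section Signs

/-- **`P_s − P_{s′} = 2·Σ_{s ≠ s′} s(σ)·Y_σ`** for two `{±1}`-valued sign functions on a finite index set (where the signs differ,
`s′ = −s`). [folklore] -/
theorem sum_sign_smul_sub_eq_two_smul {A : Type*} [AddCommGroup A] {G : Type*} [Fintype G] (s s' : G → ℤˣ) (Y : G → A) :
    ∑ σ, (s σ : ℤ) • Y σ - ∑ σ, (s' σ : ℤ) • Y σ =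
      (2 : ℤ) • ∑ σ ∈ Finset.univ.filter (fun σ ↦ s σ ≠ s' σ), (s σ : ℤ) • Y σ := by
  rw [← Finset.sum_sub_distrib, Finset.smul_sum,
    ← Finset.sum_filter_add_sum_filter_not Finset.univ (fun σ ↦ s σ ≠ s' σ)]
  have h0 : ∑ σ ∈ Finset.univ.filter (fun σ ↦ ¬ s σ ≠ s' σ), ((s σ : ℤ) • Y σ - (s' σ : ℤ) • Y σ) = 0 := by
    refine Finset.sum_eq_zero fun σ hσ ↦ ?_
    rw [Finset.mem_filter, not_not] at hσ
    rw [hσ.2, sub_self]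
  rw [h0, add_zero]
  refine Finset.sum_congr rfl fun σ hσ ↦ ?_
  rw [Finset.mem_filter] at hσ
  have hs' : (s' σ : ℤ) = -(s σ : ℤ) := by
    rcases Int.units_eq_one_or (s σ) with h | h <;> rcases Int.units_eq_one_or (s' σ) with h' | h'
    · exact absurd (h.trans h'.symm) hσ.2
    · rw [h, h']; rfl
    · rw [h, h']; rfl
    · exact absurd (h.trans h'.symm) hσ.2
  rw [hs', neg_smul, sub_neg_eq_add, ← two_smul ℤ, smul_smul, mul_comm, ← smul_smul]

/-- **`√−1 = θ/(r₀r₁)` and its sign.** In a field, if `r₀² = a`, `r₁² = l`, `θ² = −a·l` with `a, l ≠ 0`, then `j = θ/(r₀ r₁)` has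
`j² = −1`, and a ring automorphism fixing `θ` (and moving `r₀`, `r₁` at most by signs) negates `j` exactly when it acts on `r₀` and `r₁`
by DIFFERENT signs — the classes «`s_a ≠ s_ℓ`» of §2/§3 are the classes «`σ√−1 = −√−1`» of file U2d. [folklore] -/
theorem div_mul_sq_eq_neg_one_and_map_eq_neg_iff {L : Type*} [Field L] [CharZero L] (σ : L ≃+* L) {a l r₀ r₁ θ : L}
    (ha : a ≠ 0) (hl : l ≠ 0) (hr₀ : r₀ ^ 2 = a) (hr₁ : r₁ ^ 2 = l) (hθ : θ ^ 2 = -(a * l)) (hσθ : σ θ = θ)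
    (hσa : σ a = a) (hσl : σ l = l) :
    (θ / (r₀ * r₁)) ^ 2 = -1 ∧ (σ (θ / (r₀ * r₁)) = -(θ / (r₀ * r₁)) ↔ ¬ (σ r₀ = r₀ ↔ σ r₁ = r₁)) := by
  have hr₀0 : r₀ ≠ 0 := by rintro rfl; exact ha (by rw [← hr₀]; ring)
  have hr₁0 : r₁ ≠ 0 := by rintro rfl; exact hl (by rw [← hr₁]; ring)
  have hθ0 : θ ≠ 0 := by
    rintro rfl
    have : a * l = 0 := by linear_combination hθ
    exact mul_ne_zero ha hl this
  have hj0 : θ / (r₀ * r₁) ≠ 0 := div_ne_zero hθ0 (mul_ne_zero hr₀0 hr₁0)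
  refine ⟨?_, ?_⟩
  · rw [div_pow, mul_pow, hr₀, hr₁, hθ, neg_div, div_self (mul_ne_zero ha hl)]
  -- signs of `σ` on `r₀`, `r₁`
  have hs₀ : σ r₀ = r₀ ∨ σ r₀ = -r₀ := sq_eq_sq_iff_eq_or_eq_neg.mp (by rw [← map_pow, hr₀, hσa])
  have hs₁ : σ r₁ = r₁ ∨ σ r₁ = -r₁ := sq_eq_sq_iff_eq_or_eq_neg.mp (by rw [← map_pow, hr₁, hσl])
  have hne₀ : r₀ ≠ -r₀ := fun h ↦ hr₀0 (by linear_combination h / 2)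
  have hne₁ : r₁ ≠ -r₁ := fun h ↦ hr₁0 (by linear_combination h / 2)
  have hjne : θ / (r₀ * r₁) ≠ -(θ / (r₀ * r₁)) := fun h ↦ hj0 (by linear_combination h / 2)
  rw [map_div₀, map_mul, hσθ]
  rcases hs₀ with h₀ | h₀ <;> rcases hs₁ with h₁ | h₁ <;> rw [h₀, h₁]
  · exact ⟨fun h ↦ (hjne h).elim, fun h ↦ (h (iff_of_true rfl rfl)).elim⟩
  · exact ⟨fun _ h ↦ hne₁ (h.mp rfl).symm, fun _ ↦ by rw [mul_neg, div_neg]⟩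
  · exact ⟨fun _ h ↦ hne₀ (h.mpr rfl).symm, fun _ ↦ by rw [neg_mul, div_neg]⟩
  · exact ⟨fun h ↦ (hjne (by rwa [neg_mul_neg] at h)).elim,
      fun h ↦ (h ⟨fun h' ↦ (hne₀ h'.symm).elim, fun h' ↦ (hne₁ h'.symm).elim⟩).elim⟩

end Signs

end Summit.BirchSwinnertonDyer.BirchSwinnertonDyer.Theorems.GoldfeldGoodTwists

end
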